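import Summits.RiemannHypothesis.RiemannHypothesis.Theorems.EtaLeadingQuarterSecondMomentAFEInterface
import Summits.RiemannHypothesis.RiemannHypothesis.Theorems.EtaLeadingQuarterSecondMomentZerosFinal
import Summits.RiemannHypothesis.RiemannHypothesis.Theorems.UniversalFactorNarrowKernelNoGoOrdinateZero
import Summits.RiemannHypothesis.RiemannHypothesis.Theses.EtaLeadingQuarter
import HarnessLib

/-!
# `EtaLeadingSecondMoment` (route EtaLeadingQuarter, item stmt-RiemannHypothesis-21791): the
# engine in the assembly's shape, the engine hypothesis discharged, and the item closed

The zero side (seat rh-split-prover-l18-w3, `Zeros.etaLeadingSecondMoment_of_engine`, eleven files,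
with inputs of seats l18 g0/g2) reduces the route decl `EtaLeadingSecondMoment` to the per-zero AFE
ENGINE in the agreed shape (HOME/hEng.lean.txt): for `M` even, a zero `s = 1/2 + iγ` of `ζ` with
`1 ≤ γ ≤ M²`, `‖T_M(s)‖ ≤ √2 ‖S(⌊γ/(πM)⌋, γ)‖ + E`, `S(y, γ) = ∑_{k odd ≤ y} k^{-1/2} k^{-iγ}`,
`0 ≤ E ≤ c_η (1 + log M)/√M + [d ≤ η] q √(M/γ)`, `d = |γ/(πM) − round(γ/(πM))|`, every
`η ∈ (0, 1/2]`.

This file derives exactly that from part VII (`norm_altSum_le_engine`, `c_η = 27 + 8/η`,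
`q = 14√(2π)`), discharges the engine hypothesis (`engine_hypothesis`; RH is used only to place the
zero `σ + iγ_n` on the critical line, tree `UniversalFactor.narrowOrdinate_riemannZeta_eq_zero`) and closes the item (`etaLeadingSecondMoment_proof`). The engine
is parts I–VII (`SecondMomentAFE.*`): the Hardy–Littlewood approximate functional equation with
refined near-frequency errors (boundary layers), the exact cancellation of the main terms
`X^{1-s}/(1-s)` and of the even dual frequencies in `2^{1-s}P(L) − P(2L)`, and the transition-zone
bound.

HONEST LABEL: `EtaLeadingSecondMoment` is an implication `RH → (second-moment bound)`; the route is a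
rung route onto the RH-free leaf `ScrewFloorLimsupQuarter`. RH is NOT proved by any of this and
nothing here bears on the truth of RH.
-/

noncomputable section

open Complex MeasureTheory Set Filter intervalIntegral Finset
open scoped Real Topology Interval ComplexConjugate

set_option linter.dupNamespace false  -- the mandated namespace repeats `RiemannHypothesis`

namespace Summit.RiemannHypothesis.RiemannHypothesis.Theorems.EtaLeadingQuarter.SecondMomentAFE

open Literature.NumberTheory.LFunctions Literature.NumberTheory.LFunctions.AFE

/-! ## The engine in the assembly's shape -/


/-- The dual sum `∑_{odd} k^{s-1}`, `s = 1/2 + it`, is the complex conjugate of the assembly's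
`S(y, t) = ∑_{odd} k^{-1/2} k^{-it}`; in particular they have the same norm. [folklore] -/
theorem norm_dualSum_eq_norm_conj_form (K : ℕ) (t : ℝ) (s : ℂ) (hs : s = 1 / 2 + t * I) :
    ‖∑ ν ∈ (Finset.Icc 1 K).filter (fun ν => Odd ν), (ν : ℂ) ^ (s - 1)‖
      = ‖∑ k ∈ (Finset.Icc 1 K).filter Odd,
          (((1 / Real.sqrt k : ℝ)) : ℂ) * (k : ℂ) ^ (-((t : ℂ) * I))‖ := by
  have hterm : ∀ k ∈ (Finset.Icc 1 K).filter Odd,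
      (k : ℂ) ^ (s - 1) = conj ((((1 / Real.sqrt k : ℝ)) : ℂ) * (k : ℂ) ^ (-((t : ℂ) * I))) := by
    intro k hk
    have hk1 : 1 ≤ k := (Finset.mem_Icc.1 (Finset.mem_filter.1 hk).1).1
    have hk0 : (0 : ℝ) < k := by exact_mod_cast (show 0 < k by omega)
    have hkC : (k : ℂ) ≠ 0 := by exact_mod_cast (show (k : ℕ) ≠ 0 by omega)
    have harg : ((k : ℂ)).arg ≠ π := by
      rw [show (k : ℂ) = ((k : ℝ) : ℂ) by simp, Complex.arg_ofReal_of_nonneg hk0.le]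
      exact Real.pi_pos.ne
    rw [map_mul, Complex.conj_ofReal]
    have hconj : conj ((k : ℂ) ^ (-((t : ℂ) * I))) = (k : ℂ) ^ ((t : ℂ) * I) := by
      have h := Complex.cpow_conj (k : ℂ) (-((t : ℂ) * I)) harg
      rw [show conj (k : ℂ) = (k : ℂ) from Complex.conj_natCast k] at h
      rw [← h]
      congr 1
      simp [Complex.conj_ofReal, Complex.conj_I]
    rw [hconj]
    have hsqrt : (((1 / Real.sqrt k : ℝ)) : ℂ) = (k : ℂ) ^ (-(1 / 2 : ℂ)) := by
      rw [show (k : ℂ) = ((k : ℝ) : ℂ) by simp,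
        show (-(1 / 2 : ℂ)) = ((-(1 / 2 : ℝ) : ℝ) : ℂ) by push_cast; ring,
        ← Complex.ofReal_cpow hk0.le, Real.rpow_neg hk0.le, ← Real.sqrt_eq_rpow, one_div]
    rw [hsqrt, ← Complex.cpow_add _ _ hkC, hs]
    congr 1
    ring
  rw [Finset.sum_congr rfl hterm, ← map_sum, Complex.norm_conj]

/-- **The engine in the assembly's shape.** For `M = 2L` with `L ≥ 4`, a zero `s = 1/2 + it` of
`ζ` with `1 ≤ t ≤ M²`, and any `0 < η ≤ 1/2`:
`‖T_M(s)‖ ≤ √2 ‖∑_{k odd ≤ ⌊t/(πM)⌋} k^{-1/2} k^{-it}‖ + E`,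
`E = (27 + 8/η)(1 + log M)/√M + [ |t/(πM) − round(t/(πM))| ≤ η ]·14√(2π)·√(M/t)` (so `0 ≤ E`).
[folklore] -/
theorem norm_altSum_le_engine {t η : ℝ} {L : ℕ} (hL : 4 ≤ L) (ht1 : 1 ≤ t)
    (htM : t ≤ ((2 * L : ℕ) : ℝ) ^ 2) (hη0 : 0 < η) (hη : η ≤ 1 / 2)
    (s : ℂ) (hs : s = 1 / 2 + t * I) (hzero : riemannZeta s = 0) :
    ‖∑ m ∈ Finset.Icc 1 (2 * L), (-1 : ℂ) ^ m * (m : ℂ) ^ (-s)‖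
      ≤ Real.sqrt 2 * ‖∑ k ∈ (Finset.Icc 1 ⌊t / (π * ((2 * L : ℕ) : ℝ))⌋₊).filter Odd,
            (((1 / Real.sqrt k : ℝ)) : ℂ) * (k : ℂ) ^ (-((t : ℂ) * I))‖
        + ((27 + 8 / η) * (1 + Real.log ((2 * L : ℕ) : ℝ)) / Real.sqrt ((2 * L : ℕ) : ℝ)
          + (if |t / (π * ((2 * L : ℕ) : ℝ)) - round (t / (π * ((2 * L : ℕ) : ℝ)))| ≤ η
              then 14 * Real.sqrt (2 * π) * Real.sqrt (((2 * L : ℕ) : ℝ) / t) else 0)) := by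
  have hπ := Real.pi_pos
  have hπ3 := Real.pi_gt_three
  have hL1 : 1 ≤ L := by omega
  have hL0R : (0 : ℝ) < L := by exact_mod_cast (show 0 < L by omega)
  have ht0 : 0 < t := by linarith
  set M : ℝ := ((2 * L : ℕ) : ℝ) with hMdef
  have hM : M = 2 * L := by rw [hMdef]; push_cast; ring
  have hL4 : (4 : ℝ) ≤ L := by exact_mod_cast hL
  have hM8 : 8 ≤ M := by rw [hM]; linarith
  have hM0 : 0 < M := by linarith
  have hsM : 0 < Real.sqrt M := Real.sqrt_pos.2 hM0
  -- `t/(2πL) = t/(πM)`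
  have hy : t / (2 * π * L) = t / (π * M) := by rw [hM]; ring_nf
  set y : ℝ := t / (π * M) with hydef
  have hy0 : 0 < y := by rw [hydef]; positivity
  -- the dual main term has norm `≤ √2 ‖S‖`
  set SO : ℂ := ∑ ν ∈ (Finset.Icc 1 ⌊t / (2 * π * L)⌋₊).filter (fun ν => Odd ν),
    (ν : ℂ) ^ (s - 1) with hSO
  have hSnorm : ‖SO‖ = ‖∑ k ∈ (Finset.Icc 1 ⌊y⌋₊).filter Odd,
      (((1 / Real.sqrt k : ℝ)) : ℂ) * (k : ℂ) ^ (-((t : ℂ) * I))‖ := by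
    rw [hSO, hy]; exact norm_dualSum_eq_norm_conj_form _ t s hs
  have hC : ‖afeCoeff s‖ ≤ 1 := by rw [hs]; exact norm_afeCoeff_half_le_one t
  have h2 : ‖(2 : ℂ) ^ (1 - s)‖ = Real.sqrt 2 := norm_two_cpow_one_sub s hs
  have hdual : ‖afeCoeff s * (2 : ℂ) ^ (1 - s) * SO‖ ≤ Real.sqrt 2 * ‖SO‖ := by
    rw [norm_mul, norm_mul, h2]
    have : ‖afeCoeff s‖ * Real.sqrt 2 * ‖SO‖ ≤ 1 * Real.sqrt 2 * ‖SO‖ := by gcongr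
    linarith
  -- triangle inequality: `‖T‖ ≤ ‖C 2^{1-s} S‖ + ‖T + C 2^{1-s} S‖`
  set T : ℂ := ∑ m ∈ Finset.Icc 1 (2 * L), (-1 : ℂ) ^ m * (m : ℂ) ^ (-s) with hT
  have htri : ‖T‖ ≤ ‖afeCoeff s * (2 : ℂ) ^ (1 - s) * SO‖ + ‖T + afeCoeff s * (2 : ℂ) ^ (1 - s) * SO‖ := by
    have := norm_sub_le (T + afeCoeff s * (2 : ℂ) ^ (1 - s) * SO) (afeCoeff s * (2 : ℂ) ^ (1 - s) * SO)
    rw [add_sub_cancel_right] at this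
    linarith
  -- common bookkeeping: `M^{-1/2} = 1/√M`, `log(y+2) ≤ log M`
  have hA : M ^ (-(1 / 2 : ℝ)) = 1 / Real.sqrt M := by
    rw [Real.rpow_neg hM0.le, ← Real.sqrt_eq_rpow, one_div]
  have hlog : 1 + Real.log (t / (2 * π * L) + 2) ≤ 1 + Real.log M := by
    rw [hy]
    have hyM : y ≤ M / π := by
      rw [hydef, div_le_div_iff₀ (by positivity) hπ]
      have : t ≤ M ^ 2 := htM
      nlinarith
    have : y + 2 ≤ M := by
      have : M / π ≤ M / 3 := div_le_div_of_nonneg_left hM0.le (by norm_num) hπ3.le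
      linarith
    linarith [Real.log_le_log (by linarith) this]
  have hlogM0 : 0 ≤ 1 + Real.log M := by
    have : 0 ≤ Real.log M := Real.log_nonneg (by linarith); linarith
  have hmain_le : 27 * M ^ (-(1 / 2 : ℝ)) * (1 + Real.log (t / (2 * π * L) + 2))
      ≤ 27 * (1 + Real.log M) / Real.sqrt M := by
    rw [hA]
    calc 27 * (1 / Real.sqrt M) * (1 + Real.log (t / (2 * π * L) + 2))
        ≤ 27 * (1 / Real.sqrt M) * (1 + Real.log M) :=
          mul_le_mul_of_nonneg_left hlog (by positivity)
      _ = 27 * (1 + Real.log M) / Real.sqrt M := by ring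
  rw [hSnorm] at hdual
  by_cases hzone : |t / (π * M) - round (t / (π * M))| ≤ η
  · -- in the transition zone
    rw [if_pos hzone]
    have hin := norm_altSum_add_dual_le_in hL ht1 s hs hzero
    rw [← hSO, ← hMdef] at hin
    -- `14√2/√(t/(2πL)) = 14√(2π)√(M/t)`
    have hconv : 14 * Real.sqrt 2 / Real.sqrt (t / (2 * π * L)) =
        14 * Real.sqrt (2 * π) * Real.sqrt (M / t) := by
      rw [hy, hydef, Real.sqrt_div' _ (by positivity : 0 ≤ π * M), Real.sqrt_mul' _ hM0.le,
        Real.sqrt_mul' _ hπ.le, Real.sqrt_div' _ ht0.le]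
      field_simp
    have hη8 : 0 ≤ 8 / η * (1 + Real.log M) / Real.sqrt M := by positivity
    have e : (27 + 8 / η) * (1 + Real.log M) / Real.sqrt M
        = 27 * (1 + Real.log M) / Real.sqrt M + 8 / η * (1 + Real.log M) / Real.sqrt M := by ring
    rw [e]
    linarith [htri, hdual, hin, hmain_le, hconv.le, hconv.ge]
  · -- off the transition zone: `η ≤ fract y` and `η ≤ 1 - fract y`
    rw [if_neg hzone, add_zero]
    have hd : η < |t / (π * M) - round (t / (π * M))| := lt_of_not_ge hzone
    rw [abs_sub_round_eq_min] at hd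
    have hδf : η ≤ Int.fract (t / (2 * π * L)) := by rw [hy]; exact (lt_min_iff.1 hd).1.le
    have hδg : η ≤ 1 - Int.fract (t / (2 * π * L)) := by rw [hy]; exact (lt_min_iff.1 hd).2.le
    have hoff := norm_altSum_add_dual_le_off hL1 ht1 hη0 hδf hδg s hs hzero
    rw [← hSO, ← hMdef] at hoff
    have h8 : 8 * M ^ (-(1 / 2 : ℝ)) / η ≤ 8 / η * (1 + Real.log M) / Real.sqrt M := by
      rw [hA]
      have : 8 * (1 / Real.sqrt M) / η * 1 ≤ 8 * (1 / Real.sqrt M) / η * (1 + Real.log M) :=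
        mul_le_mul_of_nonneg_left (by linarith [Real.log_nonneg (by linarith : (1 : ℝ) ≤ M)])
          (by positivity)
      calc 8 * (1 / Real.sqrt M) / η = 8 * (1 / Real.sqrt M) / η * 1 := (mul_one _).symm
        _ ≤ 8 * (1 / Real.sqrt M) / η * (1 + Real.log M) := this
        _ = 8 / η * (1 + Real.log M) / Real.sqrt M := by ring
    have e : (27 + 8 / η) * (1 + Real.log M) / Real.sqrt M
        = 27 * (1 + Real.log M) / Real.sqrt M + 8 / η * (1 + Real.log M) / Real.sqrt M := by ring
    rw [e]
    linarith [htri, hdual, hoff, hmain_le, h8]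


/-! ## The engine hypothesis discharged; the item closed -/

/-- **The engine hypothesis of `Zeros.etaLeadingSecondMoment_of_engine`, discharged** (parts
I–VIII; `q = 14√(2π)`, `c_η = 27 + 8/η`; valid for every even `M ≥ 8` and every ordinate
`γ_n ≤ M²`). [folklore] -/
theorem engine_hypothesis : _root_.RiemannHypothesis → ∃ q : ℝ, 0 ≤ q ∧ ∀ η : ℝ, 0 < η → η ≤ 1 / 2 →
    ∃ c : ℝ, 0 ≤ c ∧ ∀ᶠ M : ℕ in atTop, Even M →
      ∀ n ∈ Finset.Ico (zetaZeroCount (4 * ((M / 2 : ℕ) : ℝ))) (zetaZeroCount ((M : ℝ) ^ 2)),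
        ‖∑ m ∈ Finset.Icc 1 M, (-1 : ℂ) ^ m * (m : ℂ) ^ (-((1 / 2 : ℂ) + (zetaOrdinate n : ℂ) * I))‖ ≤
          Real.sqrt 2 * ‖∑ k ∈ (Finset.Icc 1 ⌊zetaOrdinate n / (π * M)⌋₊).filter Odd,
              (((1 / Real.sqrt k : ℝ)) : ℂ) * (k : ℂ) ^ (-((zetaOrdinate n : ℂ) * I))‖ +
            (c * (1 + Real.log M) / Real.sqrt M +
              (if |zetaOrdinate n / (π * M) - round (zetaOrdinate n / (π * M))| ≤ η then
                q * Real.sqrt (M / zetaOrdinate n) else 0)) := by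
  intro hRH
  refine ⟨14 * Real.sqrt (2 * π), by positivity, fun η hη0 hη => ⟨27 + 8 / η, by positivity, ?_⟩⟩
  filter_upwards [Filter.eventually_ge_atTop 8] with M hM hEven n hn
  obtain ⟨L, hLM⟩ := hEven
  have hML : M = 2 * L := by omega
  subst hML
  have hL : 4 ≤ L := by omega
  have ht1 : 1 ≤ zetaOrdinate n := by linarith [Zeros.fourteen_lt_zetaOrdinate n]
  have hn2 : n < zetaZeroCount (((2 * L : ℕ) : ℝ) ^ 2) := (Finset.mem_Ico.1 hn).2
  have htM : zetaOrdinate n ≤ ((2 * L : ℕ) : ℝ) ^ 2 := Montgomery.zetaOrdinate_le_iff_lt.2 hn2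
  have hzero := UniversalFactor.narrowOrdinate_riemannZeta_eq_zero hRH n
  exact norm_altSum_le_engine hL ht1 htM hη0 hη (1 / 2 + (zetaOrdinate n : ℂ) * I) rfl hzero

/-- **Item stmt-RiemannHypothesis-21791 `EtaLeadingSecondMoment`, PROVED**: under RH, for every
`ε > 0` and all large `M`,
`M · ∑_ρ m(ρ) γ_ρ^{-2} ‖−1 + ∑_{m=2}^{M} (−1)^m m^{-1/2} m^{iγ_ρ}‖² ≤ (1/4 + ε) log M`.
Engine (this seat, parts I–VIII) + zero side (`Zeros.etaLeadingSecondMoment_of_engine`, seat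
rh-split-prover-l18-w3, with inputs of seats l18 g0/g2). An implication from RH; nothing here bears
on the truth of RH. [folklore] -/
theorem etaLeadingSecondMoment_proof :
    Summit.RiemannHypothesis.RiemannHypothesis.Theses.EtaLeadingQuarter.EtaLeadingSecondMoment :=
  Zeros.etaLeadingSecondMoment_of_engine engine_hypothesis


/-- **Aside item stmt-RiemannHypothesis-22406 `TailToLeading`** (the Euler-ended second moment with
its constant ⇒ the sharp-ended leading-order bound): immediate, the conclusion
`EtaLeadingSecondMoment` being proved outright. Nothing here bears on the truth of RH. [folklore] -/
theorem tailToLeading_proof :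
    Summit.RiemannHypothesis.RiemannHypothesis.Theses.EtaLeadingQuarter.TailToLeading :=
  fun _ => etaLeadingSecondMoment_proof

end Summit.RiemannHypothesis.RiemannHypothesis.Theorems.EtaLeadingQuarter.SecondMomentAFE

end
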